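import Mathlib.Analysis.Convex.KreinMilman
import Mathlib.Analysis.Convex.Join
import Mathlib.Analysis.Convex.Topology
import Mathlib.LinearAlgebra.Matrix.Determinant.Basic
import Mathlib.Topology.Algebra.Module.FiniteDimension
import Literature.Analysis.FluidPDE.FiniteFourierModeEulerGeneric
import Literature.Analysis.FluidPDE.FiniteFourierModeEulerVec

/-!
# Planar convex geometry of a face of `S^{conv}` seen from a vertex, I

Support file for `FiniteFourierModeEuler` (N. Kishimoto, T. Yoneda, J. Math. Fluid Mech. 24
(2022) 74 = arXiv:2110.08039). The proofs of Prop. 4.4 (iv) and Prop. 4.7 run around the boundary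
of a FACE `F` of the polyhedron `S^{conv}` ("let `n₁, n₂, …, n_p` be the list of all vertices of
`F` located in this order"). To make this precise we develop the elementary planar convex geometry
of the finite set `F ∩ S` of points of `S` on a supporting plane `{φ·x = M}`, `M = φ·p₀ > 0`, seen
from a distinguished vertex `p₀` (a point of maximal length):

* orientation inside the plane is the sign of the triple product `[p₀, x, y]`, and
  `triple_bridge` expresses it through the "slope" coordinates `ω·x` (`ω = p₀ × φ`) and the depth
  `d(x) = |p₀|² - p₀·x` (Cauchy–Binet), so that sorting by the slope `ω·x / d(x)` is sorting by angle
  around `p₀`;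
* vertices are the extreme points of `conv(F ∩ S)`; they lie in `F ∩ S`, contain `p₀`, and
  `F ∩ S ⊆ conv(vertices)` (Krein–Milman); an extreme point lying in a triangle with corners in the
  hull is a corner (`eq_corner_of_mem_extremePoints`);
* barycentric coordinates in the plane are triple products (`baryc_identity`).

## References

* [KishimotoYoneda2022] N. Kishimoto, T. Yoneda, J. Math. Fluid Mech. 24 (2022) 74 =
  arXiv:2110.08039, §4 (faces, edges and vertices of `S^{conv}` in Props. 4.4–4.8).
* [folklore] planar convex polygons.
-/

noncomputable section

open Matrix Set

namespace Literature.Analysis.FluidPDE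

namespace KY

/-! ### Triple products in a supporting plane -/

/-- `[a,b,c] x = [x,b,c] a + [a,x,c] b + [a,b,x] c` (Cramer). [folklore] -/
theorem cramer_triple (a b c x : Fin 3 → ℝ) :
    (a ⬝ᵥ (b ⨯₃ c)) • x
      = (x ⬝ᵥ (b ⨯₃ c)) • a + (a ⬝ᵥ (x ⨯₃ c)) • b + (a ⬝ᵥ (b ⨯₃ x)) • c := by
  ext i
  fin_cases i <;>
    · simp [cross_apply, dotProduct, Fin.sum_univ_three]
      ring

/-- In a plane `{φ·x = M}`, `M ≠ 0`, the three barycentric triple products add up: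
`[x,b,c] + [a,x,c] + [a,b,x] = [a,b,c]`. [folklore] -/
theorem baryc_sum {φ a b c x : Fin 3 → ℝ} {M : ℝ} (hM : M ≠ 0) (ha : φ ⬝ᵥ a = M)
    (hb : φ ⬝ᵥ b = M) (hc : φ ⬝ᵥ c = M) (hx : φ ⬝ᵥ x = M) :
    x ⬝ᵥ (b ⨯₃ c) + a ⬝ᵥ (x ⨯₃ c) + a ⬝ᵥ (b ⨯₃ x) = a ⬝ᵥ (b ⨯₃ c) := by
  have h := congrArg (fun v => φ ⬝ᵥ v) (cramer_triple a b c x)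
  simp only [dotProduct_smul, dotProduct_add, smul_eq_mul, ha, hb, hc, hx] at h
  have : (a ⬝ᵥ (b ⨯₃ c) - (x ⬝ᵥ (b ⨯₃ c) + a ⬝ᵥ (x ⨯₃ c) + a ⬝ᵥ (b ⨯₃ x))) * M = 0 := by
    linear_combination h
  linarith [(mul_eq_zero.1 this).resolve_right hM]

/-- Barycentric coordinates in the plane `{φ·x = M}` (`[a,b,c] ≠ 0`): `x` is the combination of
`a, b, c` with weights `[x,b,c]/[a,b,c]`, `[a,x,c]/[a,b,c]`, `[a,b,x]/[a,b,c]`, which sum to one.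
[folklore] -/
theorem baryc_identity {a b c x : Fin 3 → ℝ} (hτ : a ⬝ᵥ (b ⨯₃ c) ≠ 0) :
    x = ((x ⬝ᵥ (b ⨯₃ c)) / (a ⬝ᵥ (b ⨯₃ c))) • a + ((a ⬝ᵥ (x ⨯₃ c)) / (a ⬝ᵥ (b ⨯₃ c))) • b
      + ((a ⬝ᵥ (b ⨯₃ x)) / (a ⬝ᵥ (b ⨯₃ c))) • c := by
  have h := cramer_triple a b c x
  apply smul_right_injective (Fin 3 → ℝ) hτ
  dsimp only
  rw [h, smul_add, smul_add, smul_smul, smul_smul, smul_smul, mul_div_cancel₀ _ hτ,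
    mul_div_cancel₀ _ hτ, mul_div_cancel₀ _ hτ]

/-- Cauchy–Binet for `det[p₀, x, y] · det[p₀, φ, p₀ × φ]`, unconstrained form. [folklore] -/
theorem triple_bridge_free (φ p₀ x y : Fin 3 → ℝ) :
    ((p₀ ⨯₃ φ) ⬝ᵥ (p₀ ⨯₃ φ)) * (p₀ ⬝ᵥ (x ⨯₃ y))
      = (p₀ ⬝ᵥ p₀) * (x ⬝ᵥ φ) * ((p₀ ⨯₃ φ) ⬝ᵥ y) - (p₀ ⬝ᵥ p₀) * (y ⬝ᵥ φ) * ((p₀ ⨯₃ φ) ⬝ᵥ x)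
        - (p₀ ⬝ᵥ φ) * (x ⬝ᵥ p₀) * ((p₀ ⨯₃ φ) ⬝ᵥ y) + (p₀ ⬝ᵥ φ) * (y ⬝ᵥ p₀) * ((p₀ ⨯₃ φ) ⬝ᵥ x) := by
  simp only [dotProduct, Fin.sum_univ_three, cross_apply, Matrix.cons_val_zero, Matrix.cons_val_one,
    Matrix.cons_val_two, Matrix.head_cons, Matrix.tail_cons]
  ring

/-- **Orientation versus slope (Cauchy–Binet).** For `x, y` in the plane `{φ·z = M}` through `p₀`
(`φ·p₀ = M`): `|p₀ × φ|² [p₀, x, y] = M ( d(x) (ω·y) - d(y) (ω·x) )` with `ω = p₀ × φ` and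
`d(z) = |p₀|² - p₀·z`. Hence for `M > 0` and positive depths the sign of `[p₀, x, y]` is the sign
of `σ(y) - σ(x)`, `σ = ω·z / d(z)`. [folklore] -/
theorem triple_bridge {φ p₀ x y : Fin 3 → ℝ} {M : ℝ} (hp : p₀ ⬝ᵥ φ = M) (hx : x ⬝ᵥ φ = M)
    (hy : y ⬝ᵥ φ = M) :
    ((p₀ ⨯₃ φ) ⬝ᵥ (p₀ ⨯₃ φ)) * (p₀ ⬝ᵥ (x ⨯₃ y))
      = M * ((p₀ ⬝ᵥ p₀ - x ⬝ᵥ p₀) * ((p₀ ⨯₃ φ) ⬝ᵥ y) - (p₀ ⬝ᵥ p₀ - y ⬝ᵥ p₀) * ((p₀ ⨯₃ φ) ⬝ᵥ x)) := by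
  have U := triple_bridge_free φ p₀ x y
  linear_combination U + (p₀ ⬝ᵥ p₀) * ((p₀ ⨯₃ φ) ⬝ᵥ y) * hx - (p₀ ⬝ᵥ p₀) * ((p₀ ⨯₃ φ) ⬝ᵥ x) * hy
    - (x ⬝ᵥ p₀) * ((p₀ ⨯₃ φ) ⬝ᵥ y) * hp + (y ⬝ᵥ p₀) * ((p₀ ⨯₃ φ) ⬝ᵥ x) * hp

/-! ### Collinear points of a supporting plane -/

/-- `u × φ = 0` forces `u ∥ φ`. [folklore] -/
theorem eq_smul_of_cross_eq_zero {u φ : Fin 3 → ℝ} (hφ : φ ≠ 0) (h : u ⨯₃ φ = 0) :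
    u = ((φ ⬝ᵥ u) / (φ ⬝ᵥ φ)) • φ := by
  have key : φ ⨯₃ (u ⨯₃ φ) = (φ ⬝ᵥ φ) • u - (u ⬝ᵥ φ) • φ := cross_cross_eq_smul_sub_smul' φ u φ
  rw [h, map_zero] at key
  have hφφ : φ ⬝ᵥ φ ≠ 0 := fun h0 => hφ (dotProduct_self_eq_zero.1 h0)
  apply smul_right_injective (Fin 3 → ℝ) hφφ
  dsimp only
  rw [smul_smul, mul_div_cancel₀ _ hφφ, dotProduct_comm φ u]
  exact (sub_eq_zero.1 key.symm)

/-- Three points of the plane `{φ·z = M}` (`M ≠ 0`) with vanishing triple product are collinear: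
`s = a + θ (b - a)`. [folklore] -/
theorem exists_param_of_triple_eq_zero {φ a b s : Fin 3 → ℝ} {M : ℝ} (hM : M ≠ 0)
    (ha : φ ⬝ᵥ a = M) (hb : φ ⬝ᵥ b = M) (hs : φ ⬝ᵥ s = M) (hab : a ≠ b)
    (h0 : a ⬝ᵥ (b ⨯₃ s) = 0) : ∃ θ : ℝ, s = a + θ • (b - a) := by
  have hφ : φ ≠ 0 := by rintro rfl; simp at ha; exact hM ha.symm
  set v := b - a with hv
  set w := s - a with hw
  have hvφ : φ ⬝ᵥ v = 0 := by rw [hv, dotProduct_sub, ha, hb, sub_self]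
  have hwφ : φ ⬝ᵥ w = 0 := by rw [hw, dotProduct_sub, ha, hs, sub_self]
  -- `[a, b, s] = a · (v × w)`
  have h1 : a ⬝ᵥ (v ⨯₃ w) = 0 := by
    have : b ⨯₃ s = v ⨯₃ w + a ⨯₃ w + v ⨯₃ a := by
      rw [show b = a + v by rw [hv]; abel, show s = a + w by rw [hw]; abel]
      simp only [map_add, LinearMap.add_apply, cross_self, zero_add]
      abel
    rw [this, dotProduct_add, dotProduct_add, dot_self_cross, add_zero] at h0
    have h2 : a ⬝ᵥ (v ⨯₃ a) = 0 := by
      rw [← cross_anticomm, dotProduct_neg, dot_self_cross, neg_zero]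
    rw [h2, add_zero] at h0
    exact h0
  -- `v × w ∥ φ`, and its coefficient vanishes
  have hpar : (v ⨯₃ w) ⨯₃ φ = 0 := by
    rw [cross_cross_eq_smul_sub_smul, dotProduct_comm, hvφ, dotProduct_comm, hwφ, zero_smul, zero_smul,
      sub_self]
  have hvw : v ⨯₃ w = ((φ ⬝ᵥ (v ⨯₃ w)) / (φ ⬝ᵥ φ)) • φ := eq_smul_of_cross_eq_zero hφ hpar
  have hzero : v ⨯₃ w = 0 := by
    rw [hvw] at h1
    rw [dotProduct_smul, dotProduct_comm a φ, ha, smul_eq_mul] at h1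
    have : (φ ⬝ᵥ (v ⨯₃ w)) / (φ ⬝ᵥ φ) = 0 := (mul_eq_zero.1 h1).resolve_right hM
    rw [hvw, this, zero_smul]
  -- hence `w ∥ v`
  have hv0 : v ≠ 0 := by rw [hv]; exact sub_ne_zero.2 (Ne.symm hab)
  have hvv : v ⬝ᵥ v ≠ 0 := fun h => hv0 (dotProduct_self_eq_zero.1 h)
  have key : v ⨯₃ (v ⨯₃ w) = (v ⬝ᵥ w) • v - (v ⬝ᵥ v) • w := cross_cross_eq_smul_sub_smul' v v w
  rw [hzero, map_zero] at key
  refine ⟨(v ⬝ᵥ w) / (v ⬝ᵥ v), ?_⟩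
  have : w = ((v ⬝ᵥ w) / (v ⬝ᵥ v)) • v := by
    apply smul_right_injective (Fin 3 → ℝ) hvv
    dsimp only
    rw [smul_smul, mul_div_cancel₀ _ hvv]
    exact (sub_eq_zero.1 key.symm).symm
  rw [← this, hw]; abel

/-! ### Extreme points of the face -/

section Extreme

variable {F : Finset (Fin 3 → ℝ)}

/-- The extreme points of `conv F` lie in `F`. [folklore] -/
theorem extremePoints_subset_face :
    (convexHull ℝ (F : Set (Fin 3 → ℝ))).extremePoints ℝ ⊆ (F : Set (Fin 3 → ℝ)) :=
  extremePoints_convexHull_subset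

/-- **Krein–Milman for a finite set**: `F ⊆ conv (extreme points of conv F)`. [folklore] -/
theorem face_subset_convexHull_extremePoints :
    (F : Set (Fin 3 → ℝ)) ⊆ convexHull ℝ ((convexHull ℝ (F : Set (Fin 3 → ℝ))).extremePoints ℝ) := by
  have hcomp : IsCompact (convexHull ℝ (F : Set (Fin 3 → ℝ))) :=
    Set.Finite.isCompact_convexHull (𝕜 := ℝ) F.finite_toSet
  have hconv : Convex ℝ (convexHull ℝ (F : Set (Fin 3 → ℝ))) := convex_convexHull _ _
  have hKM := closure_convexHull_extremePoints hcomp hconv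
  have hfin : ((convexHull ℝ (F : Set (Fin 3 → ℝ))).extremePoints ℝ).Finite :=
    F.finite_toSet.subset extremePoints_subset_face
  rw [(Set.Finite.isClosed_convexHull (𝕜 := ℝ) hfin).closure_eq] at hKM
  rw [hKM]
  exact subset_convexHull _ _

/-- A linear functional bounded by `M` on `F` with `p₀` its only maximiser in `F` has `p₀` as its
only maximiser on `conv F`. [folklore] -/
theorem eq_of_dot_eq_max_of_mem_convexHull {w p₀ : Fin 3 → ℝ} (hp₀ : p₀ ∈ F)
    (hexp : ∀ s ∈ F, s ≠ p₀ → w ⬝ᵥ s < w ⬝ᵥ p₀) {x : Fin 3 → ℝ}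
    (hx : x ∈ convexHull ℝ (F : Set (Fin 3 → ℝ))) (hwx : w ⬝ᵥ x = w ⬝ᵥ p₀) : x = p₀ := by
  classical
  set G : Finset (Fin 3 → ℝ) := F.erase p₀ with hG
  by_cases hGne : G.Nonempty
  · -- a uniform gap below the maximum on `G`
    obtain ⟨s₀, hs₀, hs₀max⟩ := G.exists_max_image (fun s => w ⬝ᵥ s) hGne
    have hgap : ∀ s ∈ (G : Set (Fin 3 → ℝ)), w ⬝ᵥ s ≤ w ⬝ᵥ s₀ := fun s hs => hs₀max s hs
    have hs₀lt : w ⬝ᵥ s₀ < w ⬝ᵥ p₀ :=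
      hexp s₀ (Finset.mem_of_mem_erase hs₀) (Finset.ne_of_mem_erase hs₀)
    have hF : (F : Set (Fin 3 → ℝ)) = insert p₀ (G : Set (Fin 3 → ℝ)) := by
      rw [hG, Finset.coe_erase, Set.insert_sdiff_singleton, insert_eq_of_mem (Finset.mem_coe.2 hp₀)]
    rw [hF, convexHull_insert (by exact_mod_cast hGne), mem_convexJoin] at hx
    obtain ⟨a, ha, b, hb, hxab⟩ := hx
    rw [mem_singleton_iff] at ha
    rw [ha] at hxab
    obtain ⟨l, m, hl, hm, hlm, rfl⟩ := hxab
    have hb' : w ⬝ᵥ b ≤ w ⬝ᵥ s₀ := dot_le_of_mem_convexHull hgap hb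
    rw [dotProduct_add, dotProduct_smul, dotProduct_smul, smul_eq_mul, smul_eq_mul] at hwx
    have hm0 : m = 0 := by
      by_contra hm0
      have h' : m * (w ⬝ᵥ b - w ⬝ᵥ p₀) = 0 := by linear_combination hwx - (w ⬝ᵥ p₀) * hlm
      have := (mul_eq_zero.1 h').resolve_left hm0
      linarith
    subst hm0
    rw [add_zero] at hlm
    subst hlm
    simp
  · -- `F = {p₀}`
    have hF : (F : Set (Fin 3 → ℝ)) = {p₀} := by
      ext s
      simp only [Finset.mem_coe, mem_singleton_iff]
      constructor
      · intro hs
        by_contra hne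
        exact hGne ⟨s, Finset.mem_erase.2 ⟨hne, hs⟩⟩
      · rintro rfl; exact hp₀
    rw [hF, convexHull_singleton, mem_singleton_iff] at hx
    exact hx

/-- A strictly exposed point of `F` is an extreme point of `conv F`. [folklore] -/
theorem mem_extremePoints_of_exposed {w p₀ : Fin 3 → ℝ} (hp₀ : p₀ ∈ F)
    (hexp : ∀ s ∈ F, s ≠ p₀ → w ⬝ᵥ s < w ⬝ᵥ p₀) :
    p₀ ∈ (convexHull ℝ (F : Set (Fin 3 → ℝ))).extremePoints ℝ := by
  rw [mem_extremePoints]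
  refine ⟨subset_convexHull _ _ (Finset.mem_coe.2 hp₀), fun x₁ hx₁ x₂ hx₂ hseg => ?_⟩
  have hM : ∀ s ∈ (F : Set (Fin 3 → ℝ)), w ⬝ᵥ s ≤ w ⬝ᵥ p₀ := by
    intro s hs
    by_cases h : s = p₀
    · rw [h]
    · exact (hexp s hs h).le
  have h₁ := dot_le_of_mem_convexHull hM hx₁
  have h₂ := dot_le_of_mem_convexHull hM hx₂
  obtain ⟨a, b, ha, hb, hab, hcomb⟩ := hseg
  have hsum : w ⬝ᵥ p₀ = a * (w ⬝ᵥ x₁) + b * (w ⬝ᵥ x₂) := by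
    rw [← hcomb, dotProduct_add, dotProduct_smul, dotProduct_smul, smul_eq_mul, smul_eq_mul]
  have key : a * (w ⬝ᵥ p₀ - w ⬝ᵥ x₁) + b * (w ⬝ᵥ p₀ - w ⬝ᵥ x₂) = 0 := by
    linear_combination (w ⬝ᵥ p₀) * hab + hsum
  have t1 : 0 ≤ a * (w ⬝ᵥ p₀ - w ⬝ᵥ x₁) := mul_nonneg ha.le (sub_nonneg.2 h₁)
  have t2 : 0 ≤ b * (w ⬝ᵥ p₀ - w ⬝ᵥ x₂) := mul_nonneg hb.le (sub_nonneg.2 h₂)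
  have e₁ : w ⬝ᵥ x₁ = w ⬝ᵥ p₀ := by
    have h0 : a * (w ⬝ᵥ p₀ - w ⬝ᵥ x₁) = 0 := by linarith
    have := (mul_eq_zero.1 h0).resolve_left ha.ne'
    linarith
  have e₂ : w ⬝ᵥ x₂ = w ⬝ᵥ p₀ := by
    have h0 : b * (w ⬝ᵥ p₀ - w ⬝ᵥ x₂) = 0 := by linarith
    have := (mul_eq_zero.1 h0).resolve_left hb.ne'
    linarith
  exact ⟨eq_of_dot_eq_max_of_mem_convexHull hp₀ hexp hx₁ e₁,
    eq_of_dot_eq_max_of_mem_convexHull hp₀ hexp hx₂ e₂⟩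

/-- **An extreme point lying in a triangle with corners in the hull is a corner.** [folklore] -/
theorem eq_corner_of_mem_extremePoints {x a b c : Fin 3 → ℝ}
    (hx : x ∈ (convexHull ℝ (F : Set (Fin 3 → ℝ))).extremePoints ℝ)
    (ha : a ∈ convexHull ℝ (F : Set (Fin 3 → ℝ))) (hb : b ∈ convexHull ℝ (F : Set (Fin 3 → ℝ)))
    (hc : c ∈ convexHull ℝ (F : Set (Fin 3 → ℝ))) {α β γ : ℝ} (hα : 0 ≤ α) (hβ : 0 ≤ β)
    (hγ : 0 ≤ γ) (hsum : α + β + γ = 1) (hcomb : x = α • a + β • b + γ • c) :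
    x = a ∨ x = b ∨ x = c := by
  rw [mem_extremePoints] at hx
  obtain ⟨-, hext⟩ := hx
  have hconv : Convex ℝ (convexHull ℝ (F : Set (Fin 3 → ℝ))) := convex_convexHull _ _
  -- the point `m = (β b + γ c)/(β + γ)` of the hull
  by_cases hβγ : β + γ = 0
  · have hβ0 : β = 0 := by linarith
    have hγ0 : γ = 0 := by linarith
    left
    rw [hcomb, hβ0, hγ0, show α = 1 by linarith]; simp
  · have hβγpos : 0 < β + γ := lt_of_le_of_ne (add_nonneg hβ hγ) (Ne.symm hβγ)
    set m : Fin 3 → ℝ := (β / (β + γ)) • b + (γ / (β + γ)) • c with hm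
    have hmK : m ∈ convexHull ℝ (F : Set (Fin 3 → ℝ)) :=
      hconv hb hc (div_nonneg hβ hβγpos.le) (div_nonneg hγ hβγpos.le) (by field_simp)
    have hxm : x = α • a + (β + γ) • m := by
      rw [hcomb, hm, smul_add, smul_smul, smul_smul, mul_div_cancel₀ _ hβγ, mul_div_cancel₀ _ hβγ,
        add_assoc]
    by_cases hα0 : α = 0
    · -- `x = m` is on the segment `[b, c]`
      subst hα0
      rw [zero_smul, zero_add, show β + γ = 1 by linarith, one_smul] at hxm
      by_cases hβ0 : β = 0
      · right; right
        rw [hxm, hm, hβ0]; simp [show γ = 1 by linarith]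
      by_cases hγ0 : γ = 0
      · right; left
        rw [hxm, hm, hγ0]; simp [show β = 1 by linarith]
      -- open segment
      have hβpos : 0 < β := lt_of_le_of_ne hβ (Ne.symm hβ0)
      have hγpos : 0 < γ := lt_of_le_of_ne hγ (Ne.symm hγ0)
      have hseg : x ∈ openSegment ℝ b c := by
        refine ⟨β, γ, hβpos, hγpos, by linarith, ?_⟩
        rw [hxm, hm, show β + γ = 1 by linarith]; simp
      exact Or.inr (Or.inl (hext b hb c hc hseg).1.symm)
    · have hαpos : 0 < α := lt_of_le_of_ne hα (Ne.symm hα0)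
      have hseg : x ∈ openSegment ℝ a m := ⟨α, β + γ, hαpos, hβγpos, by linarith, hxm.symm⟩
      exact Or.inl (hext a ha m hmK hseg).1.symm

end Extreme

/-! ### Slopes around the vertex `p₀` -/

section Slope

variable {φ p₀ : Fin 3 → ℝ} {M : ℝ}

/-- The depth of `x` below the point `p₀` of maximal length: `d(x) = |p₀|² - p₀·x`. [folklore] -/
def depth (p₀ x : Fin 3 → ℝ) : ℝ := p₀ ⬝ᵥ p₀ - x ⬝ᵥ p₀

/-- The slope of `x` around `p₀` in the plane of `φ`: `(p₀ × φ)·x / d(x)` (a strictly increasing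
function of the angle at `p₀`). [folklore] -/
def slope (φ p₀ x : Fin 3 → ℝ) : ℝ := ((p₀ ⨯₃ φ) ⬝ᵥ x) / depth p₀ x

/-- **Orientation is slope order**: for points of positive depth in the plane `{φ·z = M}`, `M > 0`,
`p₀ × φ ≠ 0`: `[p₀, x, y] > 0 ↔ slope x < slope y`. [folklore] -/
theorem triple_pos_iff_slope_lt (hω : p₀ ⨯₃ φ ≠ 0) (hM : 0 < M) (hp : p₀ ⬝ᵥ φ = M)
    {x y : Fin 3 → ℝ} (hx : x ⬝ᵥ φ = M) (hy : y ⬝ᵥ φ = M) (hdx : 0 < depth p₀ x)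
    (hdy : 0 < depth p₀ y) :
    0 < p₀ ⬝ᵥ (x ⨯₃ y) ↔ slope φ p₀ x < slope φ p₀ y := by
  have hb := triple_bridge hp hx hy
  have hK0 : 0 ≤ (p₀ ⨯₃ φ) ⬝ᵥ (p₀ ⨯₃ φ) := by
    rw [real_dot_eq]; nlinarith [sq_nonneg ((p₀ ⨯₃ φ) 0), sq_nonneg ((p₀ ⨯₃ φ) 1), sq_nonneg ((p₀ ⨯₃ φ) 2)]
  have hK : 0 < (p₀ ⨯₃ φ) ⬝ᵥ (p₀ ⨯₃ φ) := lt_of_le_of_ne hK0 (Ne.symm (real_dot_self_ne_zero hω))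
  unfold slope
  rw [div_lt_div_iff₀ hdx hdy]
  unfold depth at *
  constructor
  · intro h
    have : 0 < M * ((p₀ ⬝ᵥ p₀ - x ⬝ᵥ p₀) * ((p₀ ⨯₃ φ) ⬝ᵥ y) - (p₀ ⬝ᵥ p₀ - y ⬝ᵥ p₀) * ((p₀ ⨯₃ φ) ⬝ᵥ x)) := by
      rw [← hb]; positivity
    nlinarith [(pos_iff_pos_of_mul_pos this).1 hM]
  · intro h
    have : 0 < M * ((p₀ ⬝ᵥ p₀ - x ⬝ᵥ p₀) * ((p₀ ⨯₃ φ) ⬝ᵥ y) - (p₀ ⬝ᵥ p₀ - y ⬝ᵥ p₀) * ((p₀ ⨯₃ φ) ⬝ᵥ x)) := by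
      apply mul_pos hM; nlinarith
    rw [← hb] at this
    exact (pos_iff_pos_of_mul_pos this).1 hK

/-- `[p₀, x, y] = 0 ↔ slope x = slope y` (collinear with `p₀`). [folklore] -/
theorem triple_eq_zero_iff_slope_eq (hω : p₀ ⨯₃ φ ≠ 0) (hM : 0 < M) (hp : p₀ ⬝ᵥ φ = M)
    {x y : Fin 3 → ℝ} (hx : x ⬝ᵥ φ = M) (hy : y ⬝ᵥ φ = M) (hdx : 0 < depth p₀ x)
    (hdy : 0 < depth p₀ y) :
    p₀ ⬝ᵥ (x ⨯₃ y) = 0 ↔ slope φ p₀ x = slope φ p₀ y := by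
  have hb := triple_bridge hp hx hy
  have hK : (p₀ ⨯₃ φ) ⬝ᵥ (p₀ ⨯₃ φ) ≠ 0 := real_dot_self_ne_zero hω
  unfold slope
  rw [div_eq_div_iff hdx.ne' hdy.ne']
  unfold depth at *
  constructor
  · intro h
    rw [h, mul_zero] at hb
    have := (mul_eq_zero.1 hb.symm).resolve_left hM.ne'
    linarith
  · intro h
    have : M * ((p₀ ⬝ᵥ p₀ - x ⬝ᵥ p₀) * ((p₀ ⨯₃ φ) ⬝ᵥ y) - (p₀ ⬝ᵥ p₀ - y ⬝ᵥ p₀) * ((p₀ ⨯₃ φ) ⬝ᵥ x)) = 0 := by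
      rw [show (p₀ ⬝ᵥ p₀ - x ⬝ᵥ p₀) * ((p₀ ⨯₃ φ) ⬝ᵥ y) - (p₀ ⬝ᵥ p₀ - y ⬝ᵥ p₀) * ((p₀ ⨯₃ φ) ⬝ᵥ x) = 0
        by linarith, mul_zero]
    rw [← hb] at this
    exact (mul_eq_zero.1 this).resolve_left hK

/-- The orientation of `[p₀, y, x]` is opposite: `slope x < slope y → [p₀, y, x] < 0`. [folklore] -/
theorem triple_swap (p₀ x y : Fin 3 → ℝ) : p₀ ⬝ᵥ (y ⨯₃ x) = -(p₀ ⬝ᵥ (x ⨯₃ y)) := by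
  rw [← cross_anticomm, dotProduct_neg]

/-- Points of `S` other than `p₀` have positive depth when `p₀` is strictly exposed by `x ↦ p₀·x`
(e.g. a point of maximal length). [folklore] -/
theorem depth_pos {S : Finset (Fin 3 → ℝ)} (hfar : ∀ s ∈ S, s ≠ p₀ → p₀ ⬝ᵥ s < p₀ ⬝ᵥ p₀)
    {x : Fin 3 → ℝ} (hx : x ∈ S) (hxp : x ≠ p₀) : 0 < depth p₀ x := by
  unfold depth; rw [dotProduct_comm x p₀]; linarith [hfar x hx hxp]

end Slope

end KY

end Literature.Analysis.FluidPDE
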